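import Mathlib

/-!
# `Φ₀` for two petals: reduction to the charging inequality, and the pure-`h`-petal case

Normalised two-petal setting of the (RES0′) model (prove-1 g52 §0 / g54 memo §7): masses `c, ε_Y, ε_g, ε_h ≥ 0` with
`c + ε_Y + ε_g + ε_h = 1`; petal `j` has Ȳ-face usage `x_j ≥ 1`, `k`-cell usage `k_j`, `g`-cell usage `z_j` with
`1 ≤ z_j ≤ k_j`, `h`-cell usage `r_j ≥ 1`, and value `V_j = c + ε_Y x_j + ε_g z_j + ε_h r_j`; `κ = α₀₁/α₁₁ ∈ (0,1]` is the
leverage (`r_j ≥ κ z_j` is the link `g ≤ h`).  The `G`-branch of the potential `Φ₀` (file `…SunflowerPhiZero`) is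
`Φ₀ᴳ = c + ε_Y x₁x₂ + ε_g·max(k₁k₂, r₁r₂/κ) + ε_h r₁r₂ ≤ Φ₀`.

* `pair_le_phi0G_of_charging` — the exact algebraic reduction of gen 54 memo §7(g)(ix): `V₁V₂ ≤ Φ₀ᴳ` follows from the
  CHARGING INEQUALITY `cross ≤ pay`,
  `cross = ε_gε_Y((x₁−1)ζ₂ + (x₂−1)ζ₁) + ε_hε_Y((x₁−1)ρ₂ + (x₂−1)ρ₁) + ε_gε_h(ζ₁ρ₂ + ζ₂ρ₁)`,
  `pay = ε_Y(1−ε_Y)(x₁−1)(x₂−1) + ε_h(1−ε_h)ρ₁ρ₂ + ε_g(1−ε_g)ζ₁ζ₂ + ε_g·max(r₁r₂/κ − z₁z₂, 0)` (`ζ = z−1`, `ρ = r−1`);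
  numerically `cross ≤ pay` holds on 300k random model pairs (pair_charge.py) — it is the `n = 2` case of `Phi0Conj`.
* `charging_hpetal` / `pair_le_phi0G_hpetal` — the charging inequality, hence `V₁V₂ ≤ Φ₀ᴳ`, PROVED when petal 2 is a
  pure `h`-petal (`x₂ = z₂ = k₂… = 1`), for any petal 1, from the two tying facts `ε_hε_Y(x₁−1) ≤ θ·ε_g/κ` and `θ + ε_h ≤ 1`
  (`model_tying_hpetal`: in the model `θ = τσ/g` works because `g·ε_Y(x−1) ≤ p = τ(1−σ)` and `τσ + qσα₁₁ ≤ g`): the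
  leverage pot `ε_g(r₁r₂/κ − z₁)` pays the Ȳ×h and g×h cross terms.  [this work]
-/

namespace Summit.CriticalPhenomena.PercolationContinuityZ3.Theorems.SunflowerPartition.SafeCalc.LinkedCurrency

/-- **Reduction of the two-petal `Φ₀` bound to the charging inequality** (exact algebra: with
`T₀ = c + ε_Y x₁x₂ + ε_g(z₁z₂ + (r₁r₂/κ − z₁z₂)₊) + ε_h r₁r₂ ≤ Φ₀ᴳ` one has `T₀ − V₁V₂ = pay − cross`). [this work] -/
theorem pair_le_phi0G_of_charging {c εY εg εh κ x₁ x₂ k₁ k₂ z₁ z₂ r₁ r₂ : ℝ}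
    (hsum : c + εY + εg + εh = 1) (hεg : 0 ≤ εg)
    (hz1 : 0 ≤ z₁) (hz2 : 0 ≤ z₂) (hzk1 : z₁ ≤ k₁) (hzk2 : z₂ ≤ k₂)
    (hcharge : εg * εY * ((x₁ - 1) * (z₂ - 1) + (x₂ - 1) * (z₁ - 1)) +
        εh * εY * ((x₁ - 1) * (r₂ - 1) + (x₂ - 1) * (r₁ - 1)) +
        εg * εh * ((z₁ - 1) * (r₂ - 1) + (z₂ - 1) * (r₁ - 1)) ≤
      εY * (1 - εY) * ((x₁ - 1) * (x₂ - 1)) + εh * (1 - εh) * ((r₁ - 1) * (r₂ - 1)) +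
        εg * (1 - εg) * ((z₁ - 1) * (z₂ - 1)) + εg * max (r₁ * r₂ / κ - z₁ * z₂) 0) :
    (c + εY * x₁ + εg * z₁ + εh * r₁) * (c + εY * x₂ + εg * z₂ + εh * r₂) ≤
      c + εY * (x₁ * x₂) + εg * max (k₁ * k₂) (r₁ * r₂ / κ) + εh * (r₁ * r₂) := by
  -- the G-pot dominates  z₁z₂ + (r₁r₂/κ − z₁z₂)₊
  have hK : z₁ * z₂ ≤ k₁ * k₂ := mul_le_mul hzk1 hzk2 hz2 (hz1.trans hzk1)
  have hmax : z₁ * z₂ + max (r₁ * r₂ / κ - z₁ * z₂) 0 ≤ max (k₁ * k₂) (r₁ * r₂ / κ) := by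
    rcases le_total 0 (r₁ * r₂ / κ - z₁ * z₂) with h | h
    · rw [max_eq_left h]; have := le_max_right (k₁ * k₂) (r₁ * r₂ / κ); linarith
    · rw [max_eq_right h]; have := le_max_left (k₁ * k₂) (r₁ * r₂ / κ); linarith
  have hc : c = 1 - εY - εg - εh := by linarith
  -- T₀ − V₁V₂ = pay − cross (ring identity), then use the charging hypothesis
  have key : (c + εY * (x₁ * x₂) + εg * (z₁ * z₂ + max (r₁ * r₂ / κ - z₁ * z₂) 0) + εh * (r₁ * r₂)) -
      (c + εY * x₁ + εg * z₁ + εh * r₁) * (c + εY * x₂ + εg * z₂ + εh * r₂) =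
      (εY * (1 - εY) * ((x₁ - 1) * (x₂ - 1)) + εh * (1 - εh) * ((r₁ - 1) * (r₂ - 1)) +
        εg * (1 - εg) * ((z₁ - 1) * (z₂ - 1)) + εg * max (r₁ * r₂ / κ - z₁ * z₂) 0) -
      (εg * εY * ((x₁ - 1) * (z₂ - 1) + (x₂ - 1) * (z₁ - 1)) +
        εh * εY * ((x₁ - 1) * (r₂ - 1) + (x₂ - 1) * (r₁ - 1)) +
        εg * εh * ((z₁ - 1) * (r₂ - 1) + (z₂ - 1) * (r₁ - 1))) := by
    rw [hc]; ring
  have hT : c + εY * (x₁ * x₂) + εg * (z₁ * z₂ + max (r₁ * r₂ / κ - z₁ * z₂) 0) + εh * (r₁ * r₂) ≤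
      c + εY * (x₁ * x₂) + εg * max (k₁ * k₂) (r₁ * r₂ / κ) + εh * (r₁ * r₂) := by
    have := mul_le_mul_of_nonneg_left hmax hεg
    linarith
  linarith

/-- **Charging inequality, pure-`h`-petal case.**  Petal 2 has `x₂ = z₂ = 1` (no Ȳ- and no `g`-excess) and `r₂ ≥ 1`;
petal 1 is arbitrary with `x₁ ≥ 1`, `1 ≤ z₁ ≤ w` where `w = r₁/κ` (the link `g₁ ≤ h₁`), `1/κ ≤ w` (i.e. `r₁ ≥ 1`).
If `ε_hε_Y(x₁−1) ≤ θ·ε_g/κ` and `θ + ε_h ≤ 1` (the model tying, `model_tying_hpetal`), then `cross ≤ pay`; indeed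
`cross = (r₂−1)(ε_hε_Y(x₁−1) + ε_gε_h(z₁−1)) ≤ (r₂−1)(θ + ε_h)ε_g w ≤ ε_g(w r₂ − z₁) = pot`. [this work] -/
theorem charging_hpetal {εY εg εh κ θ x₁ z₁ r₂ w : ℝ}
    (hεg : 0 ≤ εg) (hεh : 0 ≤ εh) (hθ : 0 ≤ θ) (hθh : θ + εh ≤ 1) (hκ : 0 < κ)
    (hz1 : 1 ≤ z₁) (hzw : z₁ ≤ w) (hκw : 1 / κ ≤ w) (hr2 : 1 ≤ r₂)
    (htie : εh * εY * (x₁ - 1) ≤ θ * εg * (1 / κ)) :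
    εg * εY * ((x₁ - 1) * ((1 : ℝ) - 1) + ((1 : ℝ) - 1) * (z₁ - 1)) +
        εh * εY * ((x₁ - 1) * (r₂ - 1) + ((1 : ℝ) - 1) * (κ * w - 1)) +
        εg * εh * ((z₁ - 1) * (r₂ - 1) + ((1 : ℝ) - 1) * (κ * w - 1)) ≤
      εY * (1 - εY) * ((x₁ - 1) * ((1 : ℝ) - 1)) + εh * (1 - εh) * ((κ * w - 1) * (r₂ - 1)) +
        εg * (1 - εg) * ((z₁ - 1) * ((1 : ℝ) - 1)) + εg * max (κ * w * r₂ / κ - z₁ * 1) 0 := by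
  have hρ2 : 0 ≤ r₂ - 1 := by linarith
  have hw0 : 0 ≤ w := by linarith
  -- the pot: κ w r₂ / κ − z₁ = w r₂ − z₁ ≥ w (r₂ − 1) ≥ 0
  have hpot_eq : κ * w * r₂ / κ - z₁ * 1 = w * r₂ - z₁ := by field_simp
  have hpot_ge : w * (r₂ - 1) ≤ max (κ * w * r₂ / κ - z₁ * 1) 0 := by
    rw [hpot_eq]; have := le_max_left (w * r₂ - z₁) 0; nlinarith
  -- the two cross terms against (θ + ε_h) ε_g w (r₂ − 1)
  have h1 : εh * εY * (x₁ - 1) * (r₂ - 1) ≤ θ * εg * w * (r₂ - 1) := by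
    have e1 : εh * εY * (x₁ - 1) ≤ θ * εg * w := by
      calc εh * εY * (x₁ - 1) ≤ θ * εg * (1 / κ) := htie
        _ ≤ θ * εg * w := mul_le_mul_of_nonneg_left hκw (mul_nonneg hθ hεg)
    exact mul_le_mul_of_nonneg_right e1 hρ2
  have h2 : εg * εh * (z₁ - 1) * (r₂ - 1) ≤ εh * εg * w * (r₂ - 1) := by
    have e2 : εg * εh * (z₁ - 1) ≤ εh * εg * w := by nlinarith [mul_nonneg hεg hεh]
    exact mul_le_mul_of_nonneg_right e2 hρ2
  have h3 : (θ + εh) * (εg * w * (r₂ - 1)) ≤ εg * w * (r₂ - 1) := by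
    have hnn : 0 ≤ εg * w * (r₂ - 1) := mul_nonneg (mul_nonneg hεg hw0) hρ2
    nlinarith
  have h4 : εg * (w * (r₂ - 1)) ≤ εg * max (κ * w * r₂ / κ - z₁ * 1) 0 :=
    mul_le_mul_of_nonneg_left hpot_ge hεg
  -- the h×h surplus is nonnegative (κ w = r₁ ≥ 1)
  have h5 : 0 ≤ εh * (1 - εh) * ((κ * w - 1) * (r₂ - 1)) := by
    have hκw1 : 1 ≤ κ * w := by
      have := mul_le_mul_of_nonneg_left hκw hκ.le
      rwa [mul_one_div_cancel hκ.ne'] at this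
    have : 0 ≤ 1 - εh := by linarith
    exact mul_nonneg (mul_nonneg hεh this) (mul_nonneg (by linarith) hρ2)
  nlinarith

/-- **Model tying for the pure-`h`-petal case.**  In the model (`p = τ(1−σ)`, `q = s(1−τ)`, `g ≥ τσ + qσα₁₁`, `g > 0`,
`ε_Y(x−1) = p·A/g` with `A = Ȳ − b_Ȳ ≤ 1`, `ε_h = qσα₁₁/g`, `ε_g/κ = q(1−σ)α₁₁/g`), the choice `θ = τσ/g` gives
`ε_hε_Y(x−1) ≤ θ ε_g/κ` and `θ + ε_h ≤ 1`. [this work] -/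
theorem model_tying_hpetal {τ σ s α11 g A : ℝ} (hτ0 : 0 ≤ τ) (hσ0 : 0 ≤ σ) (hσ1 : σ ≤ 1) (hs0 : 0 ≤ s)
    (hτ1 : τ ≤ 1) (hα11 : 0 ≤ α11) (hg : 0 < g) (hgll : τ * σ + s * (1 - τ) * σ * α11 ≤ g)
    (hA1 : A ≤ 1) :
    (s * (1 - τ) * σ * α11 / g) * (τ * (1 - σ) * A / g) ≤
        (τ * σ / g) * (s * (1 - τ) * (1 - σ) * α11 / g) ∧
      τ * σ / g + s * (1 - τ) * σ * α11 / g ≤ 1 := by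
  constructor
  · rw [div_mul_div_comm, div_mul_div_comm]
    apply div_le_div_of_nonneg_right _ (mul_pos hg hg).le
    have hq : 0 ≤ s * (1 - τ) := mul_nonneg hs0 (sub_nonneg.2 hτ1)
    have h1 : 0 ≤ s * (1 - τ) * σ * α11 * (τ * (1 - σ)) :=
      mul_nonneg (mul_nonneg (mul_nonneg hq hσ0) hα11) (mul_nonneg hτ0 (sub_nonneg.2 hσ1))
    nlinarith
  · rw [← add_div, div_le_one hg]; exact hgll

/-- **`Φ₀` for the pair {any petal, pure `h`-petal} (PROVED case of `Phi0Conj` at `n = 2`).**  With the notation of the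
module docstring (`w = r₁/κ`, so `r₁ = κw`), if petal 2 is a pure `h`-petal and the two tying facts hold, then
`V₁·V₂ ≤ Φ₀ᴳ ≤ Φ₀`. [this work] -/
theorem pair_le_phi0G_hpetal {c εY εg εh κ θ x₁ k₁ z₁ w r₂ : ℝ}
    (hsum : c + εY + εg + εh = 1) (hεg : 0 ≤ εg) (hεh : 0 ≤ εh) (hθ : 0 ≤ θ) (hθh : θ + εh ≤ 1)
    (hκ : 0 < κ) (hz1 : 1 ≤ z₁) (hzk1 : z₁ ≤ k₁) (hzw : z₁ ≤ w) (hκw : 1 / κ ≤ w) (hr2 : 1 ≤ r₂)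
    (htie : εh * εY * (x₁ - 1) ≤ θ * εg * (1 / κ)) :
    (c + εY * x₁ + εg * z₁ + εh * (κ * w)) * (c + εY * 1 + εg * 1 + εh * r₂) ≤
      c + εY * (x₁ * 1) + εg * max (k₁ * 1) (κ * w * r₂ / κ) + εh * (κ * w * r₂) := by
  have hch := charging_hpetal (εY := εY) hεg hεh hθ hθh hκ hz1 hzw hκw hr2 htie
  exact pair_le_phi0G_of_charging (k₂ := 1) hsum hεg (by linarith) (by norm_num) hzk1 le_rfl hch

end Summit.CriticalPhenomena.PercolationContinuityZ3.Theorems.SunflowerPartition.SafeCalc.LinkedCurrency
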